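import Summits.AtomisticToContinuum.Crystallization.Theorems.OverbindingBudgetMisfitWindow
import Summits.AtomisticToContinuum.Crystallization.Theorems.OverbindingBudgetElasticSplitDilation
import Summits.AtomisticToContinuum.Crystallization.Theorems.OverbindingBudgetElasticSplitShear

/-!
# OverbindingBudget — the misfit census BALANCED against the chunk's own stress, I: statements and seams (decomp-a2c lens-4, gen. 40)

Helper file (`--supports stmt-AtomisticToContinuum-31280`, `RobustDefectLimitWindows`).  Leaf line of record before this file: CONE XLIV
`ChargedEnergyGap → TwoShellShape (1/100) (3/50) (1/450) → RegisteredScaleGap (122/125) 0 4 (3/50) (1/450) → GapFreeShells → CleanlessExcessT →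
CoherentResidual 10 → RobustDefectLimitWindows` (`…MisfitWindow.rdef_of_ceg_shape_registered_gapFree`), whose one hard slot is the registered
scale census RSG.  Two facts about how the glue USES a census (`…MisfitWindow.misfitRelax_of_tameMisfitGap`) were not yet exploited:

1. **The bulk floor is free.**  `N·e⋆ ≤ 𝓔(y)` for EVERY injective configuration (periodisation; in the tree as the `c = 0` case of
   `ContactSaturationLadderDirectionalCharge.directionalCharge_le`, here `floor_le`).  A census is therefore pure PRICING of its bad set by the
   excess `𝓔(y) − N e⋆`; no «stability half» can be split off it.
2. **The glue applies the census once, to a cube chunk `F` of a texture, and only needs `E(#F) + κℓ³ ≤ U(F)`.**  Any PROVED competitor bound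
   `E(#F) + G(F) ≤ U(F)` can therefore be moved into the census as a REBATE `C·G(F)`: a chunk with `G(F) ≥ κ'ℓ³` is strained
   outright, a chunk with `G(F) < κ'ℓ³` loses one more `κℓ³` budget item.  The cell owns two such bounds, never threaded into the census
   line: the exact homothety identity `E(#F) + dilationGain F ≤ U(F)` (`…ElasticSplitDilation.groundStateEnergy_add_dilationGain_le`, g27;
   `dilationGain F = (S₁₂ − S₆)²/(24 S₁₂)`, the TRACE of the chunk's mean virial stress) and the uniaxial one
   `#F·e⋆ + shearGain u F ≤ U(F)` for every unit vector `u` (`…ElasticSplitShear.floor_add_shearGain_le` ← lens-1's `directionalCharge_le`;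
   the projection `uᵀσu` of the mean stress).

THIS FILE types the census of record weakened three ways at once and proves every seam but the glue (part II, `…BalancedCensus`):
* priced set: the `ρ`-DEEPLY registered scale-bad sites only (as RSG), for ANY depth `ρ ≥ 0`; rebated: EVERY site that is not `ρ`-deeply
  registered (`notDeepCount`, a superset of RSG's unregistered rebate — the defect RIM is rebated by depth, not priced);
* rebated: the off-window sites (g39's `offCount`, window `[σ₁, σ₂]`);
* rebated: the chunk's STRESS GAIN `dilGain y + shGain u y` in ONE unit direction `u` chosen by the census.
  `BalancedDeepScaleGapW a s ρ ε g σ₁ σ₂`:  `∃ c > 0, C, ∀ y injective, ∃ u, ‖u‖ = 1 ∧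
     N e⋆ + c·#{deep-registered scale-bad} − C·#{not deep-registered} − C·#off − C·N^{2/3} − C·(dilGain y + shGain u y) ≤ 𝓔(y)`,
  `TameBalancedDeepScaleGap a s ρ ε g := ∀ δ ∈ (0, 2], BalancedDeepScaleGapW a s ρ ε g δ 2` (THE NEW LEAF), and the balanced versions
  `BalancedScaleGapW / BalancedMisfitGapW / TameBalancedScaleGap / TameBalancedMisfitGap` of SEG_W / MEG_W / TSG / TMG.

PROVED here: kernel arrows `MEG_W ⇒ BMEG_W`, `SEG_W ⇒ BSEG_W`, `RSG(ρ) ⇒ BalancedDeepScaleGapW(ρ, any window)`, monotonicity in `ρ`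
(deeper is weaker), the packing seam `TwoShellShape (1/100) ε g → BalancedDeepScaleGapW a s ρ ε g σ₁ σ₂ → BalancedScaleGapW a s σ₁ σ₂`
(`0 ≤ ρ`, `0 < σ₁ ≤ σ₂`; the not-deep in-window sites lie in the windowed rim of radius `7ρ/2 + 5/2`, packed by `rimCount_le`), the gap-free seam
`BalancedScaleGapW a 0 → GapFreeShells → BalancedMisfitGapW a 0`, their TAME forms, and the competitor bounds re-indexed to injective families
(`groundStateEnergy_add_dilGain_le`, `floor_add_shGain_le`, `floor_le`).

Why STRICTLY weaker (informal; kernel direction proved, converses fail the probe battery): on the new leaf NO HOMOGENEOUS configuration is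
priced — a uniformly strained Barlow chunk has mean stress of volume order, hence stress gain `≥ κ N`, and is rebated; these are exactly the
extremisers of record of RSG/SEG (census T6 / TAG 187: the affine family, `c* ≈ 1.8·10⁻³`).  What the leaf still prices is strain
INHOMOGENEITY at zero mean stress (laminates, waves, equilibrated defect fields): compatibility + Cauchy–Born coercivity, the genuine content.
-/

namespace Summit.AtomisticToContinuum.Crystallization.Theorems.OverbindingBudgetBalancedCensusStatements

open Filter Metric Set Topology
open scoped BigOperators Classical
open Literature.MathematicalPhysics.StatisticalMechanics
open Literature.Geometry.DiscreteGeometry (IsChargeFree bondGraph nearestDist nearestDist_le_dist nearestDist_nonneg le_nearestDist bondGraph_adj)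
open Summit.AtomisticToContinuum.Crystallization.Theorems.OverbindingBudgetElasticSplitStatements (chargedCount DenseCharge SparseCharge
  dilationGain dilationGain_nonneg)
open Summit.AtomisticToContinuum.Crystallization.Theorems.OverbindingBudgetElasticSplitDilation (groundStateEnergy_add_dilationGain_le)
open Summit.AtomisticToContinuum.Crystallization.Theorems.OverbindingBudgetElasticSplitShear (dirSum shearGain floor_add_shearGain_le)
open Summit.AtomisticToContinuum.Crystallization.Theorems.OverbindingBudgetElasticSplitPricing (two_mul_interactionEnergy_eq_sum_sum_image)
open Summit.AtomisticToContinuum.Crystallization.Theorems.OverbindingBudgetMisfitCensusStatements (Bad Short Long Gap badCount scaleCount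
  gapCount MisfitEnergyGap ScaleEnergyGap GapFreeShells badCount_le_scaleCount_of_gapFree)
open Summit.AtomisticToContinuum.Crystallization.Theorems.OverbindingBudgetMisfitRegistration (Framed Reg DeepReg NearCharge regScaleCount
  unregCount RegisteredScaleGap nearCharge_of_not_framed nearCharge_of_not_deepReg)
open Summit.AtomisticToContinuum.Crystallization.Theorems.OverbindingBudgetTwoShellShape (TwoShellShape)
open Summit.AtomisticToContinuum.Crystallization.Theorems.OverbindingBudgetMisfitWindowStatements (InWindow offCount rimCount ScaleEnergyGapW
  MisfitEnergyGapW TameScaleGap TameMisfitGap rimCount_le scaleCount_le_reg_rim_off)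

variable {N : ℕ}

/-! ## §A  The rebated quantities -/

/-- The number of sites that are NOT `ρ`-deeply registered (some site within `ρ·nn` of them is charged or unframed). -/
noncomputable def notDeepCount (ρ ε g : ℝ) (y : Fin N → EuclideanSpace ℝ (Fin 3)) : ℕ :=
  Nat.card {i : Fin N // ¬ DeepReg ρ ε g y i}

/-- The dilation gain of an indexed configuration: `dilationGain` of its image chunk, `(S₁₂ − S₆)²/(24 S₁₂)`. -/
noncomputable def dilGain (y : Fin N → EuclideanSpace ℝ (Fin 3)) : ℝ :=
  dilationGain (Finset.univ.image y)

/-- The shear gain of an indexed configuration in direction `u`: `shearGain u` of its image chunk. -/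
noncomputable def shGain (u : EuclideanSpace ℝ (Fin 3)) (y : Fin N → EuclideanSpace ℝ (Fin 3)) : ℝ :=
  shearGain u (Finset.univ.image y)

/-- A fixed unit vector (the first coordinate direction), used to drop the shear rebate. -/
noncomputable def e0 : EuclideanSpace ℝ (Fin 3) := EuclideanSpace.single 0 1

/-- `‖e0‖ = 1`. [this file] -/
theorem norm_e0 : ‖e0‖ = 1 := by
  simp [e0]

/-- The directional sum is non-negative. [this file] -/
theorem dirSum_nonneg (n : ℕ) (u : EuclideanSpace ℝ (Fin 3)) (F : Finset (EuclideanSpace ℝ (Fin 3))) : 0 ≤ dirSum n u F :=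
  Finset.sum_nonneg fun _ _ => Finset.sum_nonneg fun _ _ => mul_nonneg (pow_nonneg (inv_nonneg.2 dist_nonneg) _) (sq_nonneg _)

/-- The shear (directional) gain is non-negative. [this file] -/
theorem shearGain_nonneg (u : EuclideanSpace ℝ (Fin 3)) (F : Finset (EuclideanSpace ℝ (Fin 3))) : 0 ≤ shearGain u F := by
  unfold shearGain
  refine le_min ?_ (div_nonneg (abs_nonneg _) (by norm_num))
  exact div_nonneg (mul_nonneg (by norm_num) (sq_nonneg _)) (mul_nonneg (by norm_num) (dirSum_nonneg 12 u F))

/-- The dilation gain of an indexed configuration is non-negative. [this file] -/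
theorem dilGain_nonneg (y : Fin N → EuclideanSpace ℝ (Fin 3)) : 0 ≤ dilGain y := dilationGain_nonneg _

/-- The directional gain of an indexed configuration is non-negative. [this file] -/
theorem shGain_nonneg (u : EuclideanSpace ℝ (Fin 3)) (y : Fin N → EuclideanSpace ℝ (Fin 3)) : 0 ≤ shGain u y := shearGain_nonneg _ _

/-- **Dilation competitor bound, indexed form**: `E(N) + dilGain y ≤ 𝓔(y)` for every injective family. [`groundStateEnergy_add_dilationGain_le`] -/
theorem groundStateEnergy_add_dilGain_le {y : Fin N → EuclideanSpace ℝ (Fin 3)} (hy : Function.Injective y) :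
    groundStateEnergy lennardJones 3 N + dilGain y ≤ interactionEnergy lennardJones y := by
  have h := groundStateEnergy_add_dilationGain_le (Finset.univ.image y)
  have hcard : (Finset.univ.image y).card = N := by
    rw [Finset.card_image_of_injective _ hy, Finset.card_univ, Fintype.card_fin]
  have h2 := two_mul_interactionEnergy_eq_sum_sum_image hy
  rw [hcard] at h
  unfold dilGain
  linarith

/-- **Shear competitor bound, indexed form**: `N·e⋆ + shGain u y ≤ 𝓔(y)` for every injective family and unit `u`. [`floor_add_shearGain_le`] -/
theorem floor_add_shGain_le {y : Fin N → EuclideanSpace ℝ (Fin 3)} (hy : Function.Injective y) {u : EuclideanSpace ℝ (Fin 3)}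
    (hu : ‖u‖ = 1) :
    (N : ℝ) * (⨅ Q : PeriodicConfiguration 3, Q.energyPerParticle lennardJones) + shGain u y ≤ interactionEnergy lennardJones y := by
  have h := floor_add_shearGain_le (Finset.univ.image y) hu
  have hcard : (Finset.univ.image y).card = N := by
    rw [Finset.card_image_of_injective _ hy, Finset.card_univ, Fintype.card_fin]
  have h2 := two_mul_interactionEnergy_eq_sum_sum_image hy
  rw [hcard] at h
  unfold shGain
  linarith

/-- **The bulk floor is free**: `N·e⋆ ≤ 𝓔(y)` for every injective family (the `c = 0` census is a theorem). [this file] -/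
theorem floor_le {y : Fin N → EuclideanSpace ℝ (Fin 3)} (hy : Function.Injective y) :
    (N : ℝ) * (⨅ Q : PeriodicConfiguration 3, Q.energyPerParticle lennardJones) ≤ interactionEnergy lennardJones y := by
  have h := floor_add_shGain_le hy norm_e0
  linarith [shGain_nonneg e0 y]

/-! ## §B  The balanced census statements -/

/-- **`BalancedMisfitGapW a s σ₁ σ₂` («BMEG_W»)** — MEG_W with the stress rebate: for a unit direction `u` of the census's choice,
`N e⋆ + c·#bad − C·#charged − C·#off − C·N^{2/3} − C·(dilGain y + shGain u y) ≤ 𝓔(y)`.  KERNEL-WEAKER than MEG_W. -/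
def BalancedMisfitGapW (a s σ₁ σ₂ : ℝ) : Prop :=
  ∃ c C : ℝ, 0 < c ∧ ∀ (N : ℕ) (y : Fin N → EuclideanSpace ℝ (Fin 3)), Function.Injective y →
    ∃ u : EuclideanSpace ℝ (Fin 3), ‖u‖ = 1 ∧
      (N : ℝ) * (⨅ Q : PeriodicConfiguration 3, Q.energyPerParticle lennardJones) + c * (badCount a s y : ℝ)
        - C * (chargedCount y : ℝ) - C * (offCount σ₁ σ₂ y : ℝ) - C * (N : ℝ) ^ (2 / 3 : ℝ) - C * (dilGain y + shGain u y)
        ≤ interactionEnergy lennardJones y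

/-- **`BalancedScaleGapW a s σ₁ σ₂` («BSEG_W»)** — SEG_W with the stress rebate.  KERNEL-WEAKER than SEG_W. -/
def BalancedScaleGapW (a s σ₁ σ₂ : ℝ) : Prop :=
  ∃ c C : ℝ, 0 < c ∧ ∀ (N : ℕ) (y : Fin N → EuclideanSpace ℝ (Fin 3)), Function.Injective y →
    ∃ u : EuclideanSpace ℝ (Fin 3), ‖u‖ = 1 ∧
      (N : ℝ) * (⨅ Q : PeriodicConfiguration 3, Q.energyPerParticle lennardJones) + c * (scaleCount a s y : ℝ)
        - C * (chargedCount y : ℝ) - C * (offCount σ₁ σ₂ y : ℝ) - C * (N : ℝ) ^ (2 / 3 : ℝ) - C * (dilGain y + shGain u y)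
        ≤ interactionEnergy lennardJones y

/-- **`BalancedDeepScaleGapW a s ρ ε g σ₁ σ₂` («BDSG_W», the new leaf at one window)** — prices only the `ρ`-DEEPLY `(ε, g)`-registered
scale-bad sites, rebates every not-deeply-registered site, every off-window site, the surface, and the stress gain in one unit direction. -/
def BalancedDeepScaleGapW (a s ρ ε g σ₁ σ₂ : ℝ) : Prop :=
  ∃ c C : ℝ, 0 < c ∧ ∀ (N : ℕ) (y : Fin N → EuclideanSpace ℝ (Fin 3)), Function.Injective y →
    ∃ u : EuclideanSpace ℝ (Fin 3), ‖u‖ = 1 ∧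
      (N : ℝ) * (⨅ Q : PeriodicConfiguration 3, Q.energyPerParticle lennardJones) + c * (regScaleCount a s ρ ε g y : ℝ)
        - C * (notDeepCount ρ ε g y : ℝ) - C * (offCount σ₁ σ₂ y : ℝ) - C * (N : ℝ) ^ (2 / 3 : ℝ) - C * (dilGain y + shGain u y)
        ≤ interactionEnergy lennardJones y

/-- **`TameBalancedMisfitGap a s`** — `BalancedMisfitGapW a s δ 2` for every window `[δ, 2]`, `0 < δ ≤ 2` (all the glue uses). -/
def TameBalancedMisfitGap (a s : ℝ) : Prop :=
  ∀ δ : ℝ, 0 < δ → δ ≤ 2 → BalancedMisfitGapW a s δ 2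

/-- **`TameBalancedScaleGap a s`** — `BalancedScaleGapW a s δ 2` for every `0 < δ ≤ 2`. -/
def TameBalancedScaleGap (a s : ℝ) : Prop :=
  ∀ δ : ℝ, 0 < δ → δ ≤ 2 → BalancedScaleGapW a s δ 2

/-- **`TameBalancedDeepScaleGap a s ρ ε g` — THE LEAF OF RECORD after g40**: `BalancedDeepScaleGapW a s ρ ε g δ 2` for every `0 < δ ≤ 2`.
Record instance: `a = 122/125`, `s = 0`, `ε = 3/50`, `g = 1/450`, any `ρ ≥ 0` (`ρ = 4` for comparison with cone XLIV). -/
def TameBalancedDeepScaleGap (a s ρ ε g : ℝ) : Prop :=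
  ∀ δ : ℝ, 0 < δ → δ ≤ 2 → BalancedDeepScaleGapW a s ρ ε g δ 2

/-! ## §C  Kernel arrows: the old statements imply the balanced ones (PROVED) -/

/-- MEG_W ⇒ BMEG_W (drop the stress rebate: gains are nonnegative). [this file] -/
theorem balancedMisfitGapW_of_misfitEnergyGapW {a s σ₁ σ₂ : ℝ} (h : MisfitEnergyGapW a s σ₁ σ₂) : BalancedMisfitGapW a s σ₁ σ₂ := by
  obtain ⟨c, C, hc, h⟩ := h
  refine ⟨c, max C 0, hc, fun N y hy => ⟨e0, norm_e0, ?_⟩⟩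
  have e := h N y hy
  have hC : C ≤ max C 0 := le_max_left _ _
  have hC0 : 0 ≤ max C 0 := le_max_right _ _
  have h1 : (0 : ℝ) ≤ chargedCount y := Nat.cast_nonneg _
  have h2 : (0 : ℝ) ≤ offCount σ₁ σ₂ y := Nat.cast_nonneg _
  have h3 : (0 : ℝ) ≤ (N : ℝ) ^ (2 / 3 : ℝ) := Real.rpow_nonneg (Nat.cast_nonneg _) _
  have h4 : 0 ≤ dilGain y + shGain e0 y := add_nonneg (dilGain_nonneg y) (shGain_nonneg _ y)
  nlinarith [mul_le_mul_of_nonneg_right hC h1, mul_le_mul_of_nonneg_right hC h2, mul_le_mul_of_nonneg_right hC h3, mul_nonneg hC0 h4]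

/-- SEG_W ⇒ BSEG_W. [this file] -/
theorem balancedScaleGapW_of_scaleEnergyGapW {a s σ₁ σ₂ : ℝ} (h : ScaleEnergyGapW a s σ₁ σ₂) : BalancedScaleGapW a s σ₁ σ₂ := by
  obtain ⟨c, C, hc, h⟩ := h
  refine ⟨c, max C 0, hc, fun N y hy => ⟨e0, norm_e0, ?_⟩⟩
  have e := h N y hy
  have hC : C ≤ max C 0 := le_max_left _ _
  have hC0 : 0 ≤ max C 0 := le_max_right _ _
  have h1 : (0 : ℝ) ≤ chargedCount y := Nat.cast_nonneg _
  have h2 : (0 : ℝ) ≤ offCount σ₁ σ₂ y := Nat.cast_nonneg _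
  have h3 : (0 : ℝ) ≤ (N : ℝ) ^ (2 / 3 : ℝ) := Real.rpow_nonneg (Nat.cast_nonneg _) _
  have h4 : 0 ≤ dilGain y + shGain e0 y := add_nonneg (dilGain_nonneg y) (shGain_nonneg _ y)
  nlinarith [mul_le_mul_of_nonneg_right hC h1, mul_le_mul_of_nonneg_right hC h2, mul_le_mul_of_nonneg_right hC h3, mul_nonneg hC0 h4]

/-- TMG ⇒ TameBalancedMisfitGap, TSG ⇒ TameBalancedScaleGap. [this file] -/
theorem tameBalancedMisfitGap_of_tameMisfitGap {a s : ℝ} (h : TameMisfitGap a s) : TameBalancedMisfitGap a s :=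
  fun δ hδ hδ2 => balancedMisfitGapW_of_misfitEnergyGapW (h δ hδ hδ2)

/-- Kernel arrow: `TameScaleGap a s → TameBalancedScaleGap a s`. [this file] -/
theorem tameBalancedScaleGap_of_tameScaleGap {a s : ℝ} (h : TameScaleGap a s) : TameBalancedScaleGap a s :=
  fun δ hδ hδ2 => balancedScaleGapW_of_scaleEnergyGapW (h δ hδ hδ2)

/-- An unregistered site is not deeply registered (`ρ ≥ 0`: it lies within `ρ·nn` of itself). [this file] -/
theorem unregCount_le_notDeepCount {ρ ε g : ℝ} (hρ : 0 ≤ ρ) (y : Fin N → EuclideanSpace ℝ (Fin 3)) :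
    unregCount ε g y ≤ notDeepCount ρ ε g y := by
  simp only [unregCount, notDeepCount, Nat.card_eq_fintype_card, Fintype.card_subtype]
  apply Finset.card_le_card
  intro i hi
  rw [Finset.mem_filter] at hi ⊢
  refine ⟨hi.1, fun hD => hi.2 (hD i ?_)⟩
  rw [dist_self]
  exact mul_nonneg hρ (nearestDist_nonneg y i)

/-- **RSG(ρ) ⇒ BalancedDeepScaleGapW(ρ) at every window** (`ρ ≥ 0`): same priced set; the unregistered rebate is dominated by the not-deep
rebate, the window and stress rebates are dropped. [this file] -/
theorem balancedDeepScaleGapW_of_registered {a s ρ ε g : ℝ} (σ₁ σ₂ : ℝ) (hρ : 0 ≤ ρ) (h : RegisteredScaleGap a s ρ ε g) :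
    BalancedDeepScaleGapW a s ρ ε g σ₁ σ₂ := by
  obtain ⟨c, C, hc, h⟩ := h
  refine ⟨c, max C 0, hc, fun N y hy => ⟨e0, norm_e0, ?_⟩⟩
  have e := h N y hy
  have hC : C ≤ max C 0 := le_max_left _ _
  have hC0 : 0 ≤ max C 0 := le_max_right _ _
  have h1 : (0 : ℝ) ≤ unregCount ε g y := Nat.cast_nonneg _
  have h1' : (unregCount ε g y : ℝ) ≤ notDeepCount ρ ε g y := by exact_mod_cast unregCount_le_notDeepCount hρ y
  have h2 : (0 : ℝ) ≤ offCount σ₁ σ₂ y := Nat.cast_nonneg _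
  have h3 : (0 : ℝ) ≤ (N : ℝ) ^ (2 / 3 : ℝ) := Real.rpow_nonneg (Nat.cast_nonneg _) _
  have h4 : 0 ≤ dilGain y + shGain e0 y := add_nonneg (dilGain_nonneg y) (shGain_nonneg _ y)
  nlinarith [mul_le_mul_of_nonneg_right hC h1, mul_le_mul_of_nonneg_left h1' hC0, mul_le_mul_of_nonneg_right hC h3,
    mul_nonneg hC0 h2, mul_nonneg hC0 h4]

/-- Kernel arrow: `RegisteredScaleGap a s ρ ε g → TameBalancedDeepScaleGap a s ρ ε g` (`0 ≤ ρ`). [this file] -/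
theorem tameBalancedDeepScaleGap_of_registered {a s ρ ε g : ℝ} (hρ : 0 ≤ ρ) (h : RegisteredScaleGap a s ρ ε g) :
    TameBalancedDeepScaleGap a s ρ ε g :=
  fun δ _ _ => balancedDeepScaleGapW_of_registered δ 2 hρ h

/-! ## §D  Deeper is weaker: monotonicity in `ρ` (PROVED) -/

/-- Depth is antitone: a `ρ'`-deep site is `ρ`-deep for `ρ ≤ ρ'`. [this file] -/
theorem deepReg_anti {ρ ρ' ε g : ℝ} (h : ρ ≤ ρ') {y : Fin N → EuclideanSpace ℝ (Fin 3)} {i : Fin N} (hD : DeepReg ρ' ε g y i) :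
    DeepReg ρ ε g y i :=
  fun i' hi' => hD i' (hi'.trans (mul_le_mul_of_nonneg_right h (nearestDist_nonneg y i)))

/-- The deep registered count is antitone in the depth. [this file] -/
theorem regScaleCount_anti {a s ρ ρ' ε g : ℝ} (h : ρ ≤ ρ') (y : Fin N → EuclideanSpace ℝ (Fin 3)) :
    regScaleCount a s ρ' ε g y ≤ regScaleCount a s ρ ε g y := by
  simp only [regScaleCount, Nat.card_eq_fintype_card, Fintype.card_subtype]
  apply Finset.card_le_card
  intro i hi
  rw [Finset.mem_filter] at hi ⊢
  exact ⟨hi.1, hi.2.1, deepReg_anti h hi.2.2⟩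

/-- The not-deep count is monotone in the depth. [this file] -/
theorem notDeepCount_mono {ρ ρ' ε g : ℝ} (h : ρ ≤ ρ') (y : Fin N → EuclideanSpace ℝ (Fin 3)) :
    notDeepCount ρ ε g y ≤ notDeepCount ρ' ε g y := by
  simp only [notDeepCount, Nat.card_eq_fintype_card, Fintype.card_subtype]
  apply Finset.card_le_card
  intro i hi
  rw [Finset.mem_filter] at hi ⊢
  exact ⟨hi.1, fun hD => hi.2 (deepReg_anti h hD)⟩

/-- **`BalancedDeepScaleGapW` is monotone in the depth**: `ρ ≤ ρ'` ⇒ BDSG_W(ρ) ⇒ BDSG_W(ρ') (fewer priced, more rebated). [this file] -/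
theorem balancedDeepScaleGapW_mono {a s ρ ρ' ε g σ₁ σ₂ : ℝ} (hρρ : ρ ≤ ρ') (h : BalancedDeepScaleGapW a s ρ ε g σ₁ σ₂) :
    BalancedDeepScaleGapW a s ρ' ε g σ₁ σ₂ := by
  obtain ⟨c, C, hc, h⟩ := h
  refine ⟨c, max C 0, hc, fun N y hy => ?_⟩
  obtain ⟨u, hu, e⟩ := h N y hy
  refine ⟨u, hu, ?_⟩
  have hC : C ≤ max C 0 := le_max_left _ _
  have hC0 : 0 ≤ max C 0 := le_max_right _ _
  have h1 : (0 : ℝ) ≤ notDeepCount ρ ε g y := Nat.cast_nonneg _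
  have h1' : (notDeepCount ρ ε g y : ℝ) ≤ notDeepCount ρ' ε g y := by exact_mod_cast notDeepCount_mono hρρ y
  have h0' : (regScaleCount a s ρ' ε g y : ℝ) ≤ regScaleCount a s ρ ε g y := by exact_mod_cast regScaleCount_anti hρρ y
  have h2 : (0 : ℝ) ≤ offCount σ₁ σ₂ y := Nat.cast_nonneg _
  have h3 : (0 : ℝ) ≤ (N : ℝ) ^ (2 / 3 : ℝ) := Real.rpow_nonneg (Nat.cast_nonneg _) _
  have h4 : 0 ≤ dilGain y + shGain u y := add_nonneg (dilGain_nonneg y) (shGain_nonneg _ y)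
  nlinarith [mul_le_mul_of_nonneg_right hC h1, mul_le_mul_of_nonneg_left h1' hC0, mul_le_mul_of_nonneg_left h0' hc.le,
    mul_le_mul_of_nonneg_right hC h2, mul_le_mul_of_nonneg_right hC h3, mul_le_mul_of_nonneg_right hC h4]

/-- The tame deep census is monotone in the depth: deeper pricing is a weaker statement. [this file] -/
theorem tameBalancedDeepScaleGap_mono {a s ρ ρ' ε g : ℝ} (hρρ : ρ ≤ ρ') (h : TameBalancedDeepScaleGap a s ρ ε g) :
    TameBalancedDeepScaleGap a s ρ' ε g :=
  fun δ hδ hδ2 => balancedDeepScaleGapW_mono hρρ (h δ hδ hδ2)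

/-! ## §E  The packing seam: BSEG_W from the shape slot and the deep leaf (PROVED) -/

/-- `#not-deep ≤ #windowed-rim(7ρ/2 + 5/2) + #off-window` (`ρ ≥ 0`; `nearCharge_of_not_deepReg`). [this file] -/
theorem notDeepCount_le_rim_off {ρ ε g σ₁ σ₂ : ℝ} (hρ : 0 ≤ ρ) (hT : TwoShellShape (1 / 100) ε g)
    {y : Fin N → EuclideanSpace ℝ (Fin 3)} (hy : Function.Injective y) :
    notDeepCount ρ ε g y ≤ rimCount σ₁ σ₂ (7 * ρ / 2 + 5 / 2) y + offCount σ₁ σ₂ y := by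
  simp only [notDeepCount, rimCount, offCount, Nat.card_eq_fintype_card, Fintype.card_subtype]
  calc (Finset.univ.filter fun i => ¬ DeepReg ρ ε g y i).card
      ≤ ((Finset.univ.filter fun i => InWindow σ₁ σ₂ y i ∧ NearCharge (7 * ρ / 2 + 5 / 2) y i) ∪
          (Finset.univ.filter fun i => ¬ InWindow σ₁ σ₂ y i)).card := by
        apply Finset.card_le_card
        intro i hi
        rw [Finset.mem_filter] at hi
        rw [Finset.mem_union, Finset.mem_filter, Finset.mem_filter]
        by_cases hW : InWindow σ₁ σ₂ y i
        · exact Or.inl ⟨hi.1, hW, nearCharge_of_not_deepReg hρ hT hy hi.2⟩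
        · exact Or.inr ⟨hi.1, hW⟩
    _ ≤ _ := Finset.card_union_le _ _

/-- **THE PACKING SEAM.  `TwoShellShape (1/100) ε g → BalancedDeepScaleGapW a s ρ ε g σ₁ σ₂ → BalancedScaleGapW a s σ₁ σ₂`** (`0 ≤ ρ`,
`0 < σ₁ ≤ σ₂`): a scale-bad site is deeply registered (priced), in the windowed rim of radius `R = 7ρ/2 + 5/2` (at most
`K = 27(2Rσ₂ + σ₁)³/σ₁³` per charged site), or off-window; the not-deep rebate is bounded the same way; the stress rebate rides along.
Constants: `c = c₁`, `C = 2C₁⁺ + c₁ + (C₁⁺ + c₁) K`. [this file] -/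
theorem balancedScaleGapW_of_deep {a s ρ ε g σ₁ σ₂ : ℝ} (hρ : 0 ≤ ρ) (hσ : 0 < σ₁) (hσσ : σ₁ ≤ σ₂)
    (hT : TwoShellShape (1 / 100) ε g) (hD : BalancedDeepScaleGapW a s ρ ε g σ₁ σ₂) : BalancedScaleGapW a s σ₁ σ₂ := by
  obtain ⟨c₁, C₁, hc₁, h₁⟩ := hD
  set D₁ : ℝ := max C₁ 0 with hD₁
  have hD₁0 : 0 ≤ D₁ := le_max_right _ _
  have hC₁le : C₁ ≤ D₁ := le_max_left _ _
  set R : ℝ := 7 * ρ / 2 + 5 / 2 with hRdef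
  have hR0 : 0 ≤ R := by rw [hRdef]; positivity
  set K : ℝ := 27 / σ₁ ^ 3 * (2 * R * σ₂ + σ₁) ^ 3 with hK
  have hK0 : 0 ≤ K := by
    rw [hK]
    have : 0 ≤ 2 * R * σ₂ + σ₁ := by nlinarith
    positivity
  have hDK : 0 ≤ (D₁ + c₁) * K := by positivity
  refine ⟨c₁, 2 * D₁ + c₁ + (D₁ + c₁) * K, hc₁, fun N y hy => ?_⟩
  obtain ⟨u, hu, e₁⟩ := h₁ N y hy
  refine ⟨u, hu, ?_⟩
  have hS : (scaleCount a s y : ℝ) ≤ regScaleCount a s ρ ε g y + rimCount σ₁ σ₂ R y + offCount σ₁ σ₂ y := by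
    exact_mod_cast scaleCount_le_reg_rim_off hρ hT hy
  have hU : (notDeepCount ρ ε g y : ℝ) ≤ rimCount σ₁ σ₂ R y + offCount σ₁ σ₂ y := by
    exact_mod_cast notDeepCount_le_rim_off hρ hT hy
  have hP : (rimCount σ₁ σ₂ R y : ℝ) ≤ K * chargedCount y := by
    have := rimCount_le hσ hσσ hR0 hy (R := R)
    rw [hK]
    exact this
  have hB0 : (0 : ℝ) ≤ rimCount σ₁ σ₂ R y := Nat.cast_nonneg _
  have hU0 : (0 : ℝ) ≤ notDeepCount ρ ε g y := Nat.cast_nonneg _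
  have hm0 : (0 : ℝ) ≤ chargedCount y := Nat.cast_nonneg _
  have ho0 : (0 : ℝ) ≤ offCount σ₁ σ₂ y := Nat.cast_nonneg _
  have hN23 : (0 : ℝ) ≤ (N : ℝ) ^ (2 / 3 : ℝ) := Real.rpow_nonneg (Nat.cast_nonneg _) _
  have hG0 : 0 ≤ dilGain y + shGain u y := add_nonneg (dilGain_nonneg y) (shGain_nonneg _ y)
  -- (α) with the nonnegative rebate constant `D₁`
  have g1 := mul_le_mul_of_nonneg_right hC₁le hU0
  have g2 := mul_le_mul_of_nonneg_right hC₁le ho0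
  have g3 := mul_le_mul_of_nonneg_right hC₁le hN23
  have g4 := mul_le_mul_of_nonneg_right hC₁le hG0
  -- (β) the bookkeeping
  have f1 := mul_le_mul_of_nonneg_left hS hc₁.le
  have f2 := mul_le_mul_of_nonneg_left hU hD₁0
  have f3 : (c₁ + D₁) * (rimCount σ₁ σ₂ R y : ℝ) ≤ (c₁ + D₁) * (K * chargedCount y) := mul_le_mul_of_nonneg_left hP (by positivity)
  have f4 : (c₁ + D₁) * (K * (chargedCount y : ℝ)) ≤ (2 * D₁ + c₁ + (D₁ + c₁) * K) * chargedCount y := by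
    have : (c₁ + D₁) * (K * (chargedCount y : ℝ)) = ((D₁ + c₁) * K) * chargedCount y := by ring
    rw [this]
    exact mul_le_mul_of_nonneg_right (by linarith) hm0
  have f5 : (c₁ + 2 * D₁) * (offCount σ₁ σ₂ y : ℝ) ≤ (2 * D₁ + c₁ + (D₁ + c₁) * K) * offCount σ₁ σ₂ y :=
    mul_le_mul_of_nonneg_right (by linarith) ho0
  have f6 : D₁ * (N : ℝ) ^ (2 / 3 : ℝ) ≤ (2 * D₁ + c₁ + (D₁ + c₁) * K) * (N : ℝ) ^ (2 / 3 : ℝ) :=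
    mul_le_mul_of_nonneg_right (by linarith) hN23
  have f7 : D₁ * (dilGain y + shGain u y) ≤ (2 * D₁ + c₁ + (D₁ + c₁) * K) * (dilGain y + shGain u y) :=
    mul_le_mul_of_nonneg_right (by linarith) hG0
  have f1' : c₁ * (scaleCount a s y : ℝ) ≤ c₁ * regScaleCount a s ρ ε g y + c₁ * rimCount σ₁ σ₂ R y + c₁ * offCount σ₁ σ₂ y := by
    rw [← mul_add, ← mul_add]; exact f1
  have f2' : D₁ * (notDeepCount ρ ε g y : ℝ) ≤ D₁ * rimCount σ₁ σ₂ R y + D₁ * offCount σ₁ σ₂ y := by rw [← mul_add]; exact f2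
  have f34 : (c₁ + D₁) * (rimCount σ₁ σ₂ R y : ℝ) ≤ (2 * D₁ + c₁ + (D₁ + c₁) * K) * chargedCount y := f3.trans f4
  linarith [f1', f2', f34, f5, f6, f7, g1, g2, g3, g4, e₁]

/-- **TameBalancedScaleGap from the shape slot and the tame deep leaf** (`ρ ≥ 0`). [this file] -/
theorem tameBalancedScaleGap_of_deep {a s ρ ε g : ℝ} (hρ : 0 ≤ ρ) (hT : TwoShellShape (1 / 100) ε g)
    (hD : TameBalancedDeepScaleGap a s ρ ε g) : TameBalancedScaleGap a s :=
  fun _ hδ hδ2 => balancedScaleGapW_of_deep hρ hδ hδ2 hT (hD _ hδ hδ2)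

/-! ## §F  The gap-free seam (PROVED) -/

/-- **BMEG_W at margin `0` from BSEG_W and gap-free shells** (`#bad ≤ #scale` there). [this file] -/
theorem balancedMisfitGapW_zero_of_scale_gapFree {a σ₁ σ₂ : ℝ} (hS : BalancedScaleGapW a 0 σ₁ σ₂) (hGF : GapFreeShells) :
    BalancedMisfitGapW a 0 σ₁ σ₂ := by
  obtain ⟨c, C, hc, h⟩ := hS
  refine ⟨c, C, hc, fun N y hy => ?_⟩
  obtain ⟨u, hu, e⟩ := h N y hy
  refine ⟨u, hu, ?_⟩
  have hle : (badCount a 0 y : ℝ) ≤ scaleCount a 0 y := by exact_mod_cast badCount_le_scaleCount_of_gapFree hGF hy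
  have := mul_le_mul_of_nonneg_left hle hc.le
  linarith

/-- TameBalancedMisfitGap at margin `0` from TameBalancedScaleGap and gap-free shells. [this file] -/
theorem tameBalancedMisfitGap_zero_of_scale_gapFree {a : ℝ} (hS : TameBalancedScaleGap a 0) (hGF : GapFreeShells) :
    TameBalancedMisfitGap a 0 :=
  fun δ hδ hδ2 => balancedMisfitGapW_zero_of_scale_gapFree (hS δ hδ hδ2) hGF

/-- The chain to the glue's input: `TwoShellShape (1/100) ε g → TameBalancedDeepScaleGap a 0 ρ ε g → GapFreeShells → TameBalancedMisfitGap a 0`. -/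
theorem tameBalancedMisfitGap_of_shape_deep_gapFree {a ρ ε g : ℝ} (hρ : 0 ≤ ρ) (hT : TwoShellShape (1 / 100) ε g)
    (hD : TameBalancedDeepScaleGap a 0 ρ ε g) (hGF : GapFreeShells) : TameBalancedMisfitGap a 0 :=
  tameBalancedMisfitGap_zero_of_scale_gapFree (tameBalancedScaleGap_of_deep hρ hT hD) hGF

end Summit.AtomisticToContinuum.Crystallization.Theorems.OverbindingBudgetBalancedCensusStatements
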